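import Summits.QuantumAdvantage.QuantumAdvantage.Theorems.CubicForrelationNearExactIsExactRothaus

/-!
# Crux `CubicForrelation.NearExactIsExact` (stmt-QuantumAdvantage-14043), line `direct-sum-amplification` —
stub AX: Ax's theorem / McEliece's divisibility theorem for `q = 2`, on coordinate cubes

In the tree's `Bool` / `IsDegLeFun` / `signOf` vocabulary: for a Boolean function `h` on `n` bits of algebraic
degree `≤ d` (`d ≥ 1`) and a coordinate set `K`, the bias sum of `h` over the coordinate cube
`E_K = {x : supp x ⊆ K}` (written `{u : Fin n → Bool | ∀ i, u i = true → i ∈ K}`, as in the Rothaus file) is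
divisible by `2^{⌈|K|/d⌉}`:
`Σ_{x ∈ E_K} (−1)^{h(x)} ∈ 2^{(|K| + d − 1)/d} ℤ` (`stub_axParity`). This is Ax's theorem (1964) / McEliece's
theorem (1972) for `q = 2` — the weights of `RM(d,k)` are divisible by `2^{⌈k/d⌉−1}` (Carlet 2020 §4.1,
MacWilliams–Sloane Ch. 15 §3) — stated on cubes so that it applies verbatim to restrictions; it feeds Hou's
dual-degree bound (stub HOU of the line).

Elementary proof (no Gauss sums). Let `p = Σ_{s ∈ supp p} X^s` represent `h` (coefficients in `𝔽₂`, so every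
monomial in the support has coefficient `1`, `ax_coeff_eq_one`). On `0/1` points `X^s(x) = [supp s ⊆ supp x]`
(`t^e = t` on `{0,1}` for `e ≥ 1`), so `p(x) = #{s : supp s ⊆ supp x} mod 2` (`ax_eval_pt`) and
`(−1)^{h(x)} = Π_s (1 − 2·[supp s ⊆ supp x])` (`ax_signOf_polyPhase`). Expanding the product
(`Finset.prod_one_add`, `ax_prod_sign_eq`) gives `Σ_{S ⊆ supp p} (−2)^{|S|} [U_S ⊆ supp x]` with
`U_S = ⋃_{s ∈ S} supp s` (`ax_prod_indicator`), and summing over the cube,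
`#{x : U_S ⊆ supp x ⊆ K} = 2^{|K| − |U_S|} · [U_S ⊆ K]` (`ax_card_cube_sup`, via the bijection `x ↦ supp x` onto
the interval `[U_S, K]` of the Boolean lattice and `Finset.card_Icc_finset`). The `S`-term therefore has 2-adic
valuation `|S| + |K| − |U_S| ≥ ⌈|K|/d⌉` (`ax_exp_le`), because `|U_S| ≤ |K|` and `|U_S| ≤ d |S|`
(`|supp s| ≤ deg s ≤ d`, `ax_card_biUnion_le`): if `|S| ≥ c := ⌈|K|/d⌉` this is clear, and otherwise
`|K| − (d − 1)|S| ≥ |K| − (d − 1)(c − 1) ≥ c` since `d c ≤ |K| + d − 1`.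

References: J. Ax, *Zeroes of polynomials over finite fields*, Amer. J. Math. 86 (1964) 255–261; R. J. McEliece,
*Weight congruences for p-ary cyclic codes*, Discrete Math. 3 (1972) 177–192; C. Carlet, *Boolean Functions for
Cryptography and Coding Theory*, CUP 2020, §4.1 (McEliece's theorem); F. J. MacWilliams, N. J. A. Sloane,
*The Theory of Error-Correcting Codes* (1977), Ch. 15 §3. Everything below is proved from Mathlib and the tree
(`polyPhase_apply`, `signOf`); axioms are the standard three.
-/

set_option linter.dupNamespace false -- D-0017: single-problem summit ⇒ `QuantumAdvantage.QuantumAdvantage` by design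

noncomputable section

namespace Summit.QuantumAdvantage.QuantumAdvantage.Theorems.CubicForrelation.NearExactIsExact

open Finset
open Literature.Computability.QuantumComplexity

variable {n : ℕ}

/-! ### Arithmetic in `𝔽₂` and the exponent bound -/

/-- In `𝔽₂` every nonzero element is `1`. [folklore] -/
theorem ax_zmod2_eq_one : ∀ c : ZMod 2, c ≠ 0 → c = 1 := by decide

/-- Every monomial in the support of a polynomial over `𝔽₂` has coefficient `1`. [folklore] -/
theorem ax_coeff_eq_one {p : MvPolynomial (Fin n) (ZMod 2)} {s : Fin n →₀ ℕ} (hs : s ∈ p.support) :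
    p.coeff s = 1 :=
  ax_zmod2_eq_one _ (MvPolynomial.mem_support_iff.1 hs)

/-- The exponent arithmetic of Ax's theorem: if `u ≤ k`, `u ≤ d t` and `d ≥ 1` then `⌈k/d⌉ ≤ t + k − u`
(`⌈k/d⌉ = (k + d − 1)/d`): either `t ≥ ⌈k/d⌉`, or `t ≤ ⌈k/d⌉ − 1` and then
`k − (d−1) t ≥ k − (d−1)(⌈k/d⌉−1) ≥ ⌈k/d⌉`. [folklore] -/
theorem ax_exp_le {k u d t : ℕ} (hd : 1 ≤ d) (huk : u ≤ k) (hut : u ≤ d * t) :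
    (k + d - 1) / d ≤ t + k - u := by
  have h1 := Nat.div_mul_le_self (k + d - 1) d
  set c := (k + d - 1) / d
  rcases Nat.lt_or_ge t c with htc | hct
  · have hkd : 1 ≤ k + d := by omega
    have hutk : u ≤ t + k := by omega
    zify [hutk, hkd] at h1 hut htc ⊢
    nlinarith [mul_le_mul_of_nonneg_left (show (t : ℤ) + 1 ≤ c by exact_mod_cast htc)
      (show (0 : ℤ) ≤ (d : ℤ) - 1 by linarith [(by exact_mod_cast hd : (1 : ℤ) ≤ d)])]
  · omega

/-! ### Values and signs of a polynomial over `𝔽₂` at `0/1` points -/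

/-- At a `0/1` point, a polynomial over `𝔽₂` evaluates to the number (mod `2`) of monomials in its support whose
variables are all switched on: `X^s(x) = [supp s ⊆ supp x]` since `t^e = t` on `{0,1}` for `e ≥ 1`.
[cite: Carlet2020, §2.2.1 eq. (2.1)] -/
theorem ax_eval_pt (p : MvPolynomial (Fin n) (ZMod 2)) (x : Fin n → Bool) :
    MvPolynomial.eval (fun j => if x j then (1 : ZMod 2) else 0) p =
      ∑ s ∈ p.support, if (∀ j ∈ s.support, x j = true) then (1 : ZMod 2) else 0 := by
  rw [MvPolynomial.eval_eq]
  refine sum_congr rfl fun s hs => ?_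
  rw [ax_coeff_eq_one hs, one_mul]
  by_cases hall : ∀ j ∈ s.support, x j = true
  · rw [if_pos hall]
    refine prod_eq_one fun i hi => ?_
    rw [if_pos (hall i hi), one_pow]
  · rw [if_neg hall]
    push Not at hall
    obtain ⟨i, hi, hxi⟩ := hall
    refine prod_eq_zero hi ?_
    rw [if_neg hxi, zero_pow (Finsupp.mem_support_iff.1 hi)]

/-- The sign `(−1)^{p(x)}` of a polynomial phase is the product over the monomials `s` of `p` of
`(−1)^{[supp s ⊆ supp x]}` (an integer, cast to `ℝ`). [cite: Carlet2020, §2.2.1 eq. (2.1)] -/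
theorem ax_signOf_polyPhase (p : MvPolynomial (Fin n) (ZMod 2)) (x : Fin n → Bool) :
    signOf (polyPhase p x) =
      ((∏ s ∈ p.support, (if (∀ j ∈ s.support, x j = true) then (-1 : ℤ) else 1) : ℤ) : ℝ) := by
  rw [polyPhase_apply, ax_eval_pt, sum_boole, prod_ite, prod_const, prod_const_one, mul_one]
  set N := #{s ∈ p.support | ∀ j ∈ s.support, x j = true}
  rcases Nat.even_or_odd N with hN | hN
  · rw [hN.neg_one_pow, ZMod.natCast_eq_zero_iff_even.2 hN]
    simp [signOf]
  · rw [hN.neg_one_pow, ZMod.natCast_eq_one_iff_odd.2 hN]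
    simp [signOf]

/-! ### Expanding `Π_s (1 − 2·[supp s ⊆ supp x])` and counting over the cube -/

/-- `Π_{s ∈ T} (−1)^{[supp s ⊆ supp x]} = Σ_{S ⊆ T} Π_{s ∈ S} (−2·[supp s ⊆ supp x])` (`Finset.prod_one_add` with
`(−1)^{[P]} = 1 + (−2)[P]`). [folklore] -/
theorem ax_prod_sign_eq (T : Finset (Fin n →₀ ℕ)) (x : Fin n → Bool) :
    ∏ s ∈ T, (if (∀ j ∈ s.support, x j = true) then (-1 : ℤ) else 1) =
      ∑ S ∈ T.powerset, ∏ s ∈ S, (if (∀ j ∈ s.support, x j = true) then (-2 : ℤ) else 0) := by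
  rw [← prod_one_add]
  refine prod_congr rfl fun s _ => ?_
  split_ifs <;> norm_num

/-- `Π_{s ∈ S} (−2·[supp s ⊆ supp x]) = (−2)^{|S|} · [U_S ⊆ supp x]` with `U_S = ⋃_{s ∈ S} supp s`. [folklore] -/
theorem ax_prod_indicator (S : Finset (Fin n →₀ ℕ)) (x : Fin n → Bool) :
    ∏ s ∈ S, (if (∀ j ∈ s.support, x j = true) then (-2 : ℤ) else 0) =
      if (∀ j ∈ S.biUnion fun s => s.support, x j = true) then (-2 : ℤ) ^ #S else 0 := by
  by_cases hall : ∀ s ∈ S, ∀ j ∈ s.support, x j = true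
  · rw [if_pos, ← prod_const]
    · exact prod_congr rfl fun s hs => if_pos (hall s hs)
    · intro j hj
      obtain ⟨s, hs, hjs⟩ := mem_biUnion.1 hj
      exact hall s hs j hjs
  · rw [if_neg]
    · obtain ⟨s, hs⟩ := not_forall.1 hall
      obtain ⟨hs, hsx⟩ := Classical.not_imp.1 hs
      exact prod_eq_zero hs (if_neg hsx)
    · intro h
      exact hall fun s hs j hjs => h j (mem_biUnion.2 ⟨s, hs, hjs⟩)

/-- Cube counting: for `U ⊆ K`, `#{x : U ⊆ supp x ⊆ K} = 2^{|K| − |U|}` — the support map is a bijection onto the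
interval `[U, K]` of the Boolean lattice (`Finset.card_Icc_finset`). [folklore] -/
theorem ax_card_cube_sup {U K : Finset (Fin n)} (hU : U ⊆ K) :
    #({x : Fin n → Bool | (∀ i, x i = true → i ∈ K) ∧ ∀ j ∈ U, x j = true} : Finset (Fin n → Bool)) =
      2 ^ (#K - #U) := by
  rw [← card_Icc_finset hU]
  refine card_bij' (fun x _ => ({i | x i = true} : Finset (Fin n))) (fun I _ i => decide (i ∈ I))
    ?_ ?_ ?_ ?_
  · intro x hx
    simp only [mem_filter, mem_univ, true_and] at hx
    rw [mem_Icc]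
    refine ⟨fun j hj => ?_, fun i hi => hx.1 i ?_⟩
    · simpa using hx.2 j hj
    · simpa using hi
  · intro I hI
    rw [mem_Icc] at hI
    simp only [mem_filter, mem_univ, true_and, decide_eq_true_eq]
    exact ⟨fun i hi => hI.2 hi, fun j hj => hI.1 hj⟩
  · intro x _
    funext i
    simp
  · intro I _
    ext i
    simp

/-- Cube counting, degenerate case: if `U ⊄ K` no `x` has `U ⊆ supp x ⊆ K`. [folklore] -/
theorem ax_card_cube_sup_eq_zero {U K : Finset (Fin n)} (hU : ¬ U ⊆ K) :
    #({x : Fin n → Bool | (∀ i, x i = true → i ∈ K) ∧ ∀ j ∈ U, x j = true} : Finset (Fin n → Bool)) = 0 := by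
  rw [card_eq_zero, filter_eq_empty_iff]
  intro x _ hx
  exact hU fun j hj => hx.1 j (hx.2 j hj)

/-! ### Degree bookkeeping: `|U_S| ≤ d |S|` -/

/-- A monomial of a polynomial of total degree `≤ d` involves at most `d` variables: `|supp s| ≤ deg s ≤ d`.
[folklore] -/
theorem ax_card_support_le {d : ℕ} {p : MvPolynomial (Fin n) (ZMod 2)} (hp : p.totalDegree ≤ d)
    {s : Fin n →₀ ℕ} (hs : s ∈ p.support) : #s.support ≤ d := by
  refine le_trans ?_ ((MvPolynomial.le_totalDegree hs).trans hp)
  show #s.support ≤ ∑ i ∈ s.support, s i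
  rw [card_eq_sum_ones]
  exact sum_le_sum fun i hi => Nat.one_le_iff_ne_zero.2 (Finsupp.mem_support_iff.1 hi)

/-- `|⋃_{s ∈ S} supp s| ≤ d |S|` for a set `S` of monomials of a polynomial of total degree `≤ d`. [folklore] -/
theorem ax_card_biUnion_le {d : ℕ} {p : MvPolynomial (Fin n) (ZMod 2)} (hp : p.totalDegree ≤ d)
    {S : Finset (Fin n →₀ ℕ)} (hS : S ⊆ p.support) : #(S.biUnion fun s => s.support) ≤ d * #S := by
  refine card_biUnion_le.trans ?_
  rw [mul_comm, ← smul_eq_mul, ← sum_const]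
  exact sum_le_sum fun s hs => ax_card_support_le hp (hS hs)

/-! ### Divisibility of the `S`-terms and of the bias sum -/

/-- The `S`-term of the expansion, summed over the cube `E_K`, is `(−2)^{|S|} · 2^{|K| − |U_S|} · [U_S ⊆ K]`, hence
divisible by `2^{⌈|K|/d⌉}` (`ax_exp_le` with `|U_S| ≤ |K|`, `|U_S| ≤ d |S|`). [cite: Carlet2020, §4.1] -/
theorem ax_term_dvd {d : ℕ} (hd : 1 ≤ d) {p : MvPolynomial (Fin n) (ZMod 2)} (hp : p.totalDegree ≤ d)
    (K : Finset (Fin n)) {S : Finset (Fin n →₀ ℕ)} (hS : S ⊆ p.support) :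
    (2 : ℤ) ^ ((#K + d - 1) / d) ∣
      ∑ x ∈ {u : Fin n → Bool | ∀ i, u i = true → i ∈ K},
        ∏ s ∈ S, (if (∀ j ∈ s.support, x j = true) then (-2 : ℤ) else 0) := by
  simp_rw [ax_prod_indicator]
  rw [← sum_filter, sum_const, filter_filter, nsmul_eq_mul]
  by_cases hU : (S.biUnion fun s => s.support) ⊆ K
  · rw [ax_card_cube_sup hU, neg_pow, Nat.cast_pow, Nat.cast_ofNat, mul_left_comm, ← pow_add]
    refine Dvd.dvd.mul_left (pow_dvd_pow 2 ?_) _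
    have h := ax_exp_le hd (card_le_card hU) (ax_card_biUnion_le hp hS)
    omega
  · rw [ax_card_cube_sup_eq_zero hU, Nat.cast_zero, zero_mul]
    exact dvd_zero _

/-- The integer bias sum `Σ_{x ∈ E_K} Π_s (−1)^{[supp s ⊆ supp x]}` of a polynomial of total degree `≤ d` (`d ≥ 1`)
over the cube `E_K` is divisible by `2^{⌈|K|/d⌉}`: expand, swap the sums, and apply `ax_term_dvd` termwise.
[cite: Carlet2020, §4.1] -/
theorem ax_sum_cube_dvd {d : ℕ} (hd : 1 ≤ d) {p : MvPolynomial (Fin n) (ZMod 2)} (hp : p.totalDegree ≤ d)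
    (K : Finset (Fin n)) :
    (2 : ℤ) ^ ((#K + d - 1) / d) ∣
      ∑ x ∈ {u : Fin n → Bool | ∀ i, u i = true → i ∈ K},
        ∏ s ∈ p.support, (if (∀ j ∈ s.support, x j = true) then (-1 : ℤ) else 1) := by
  simp_rw [ax_prod_sign_eq]
  rw [sum_comm]
  exact dvd_sum fun S hS => ax_term_dvd hd hp K (mem_powerset.1 hS)

/-- **stub_axParity** (AX; Ax 1964 / McEliece 1972 for `q = 2`, Carlet 2020 §4.1 "McEliece's theorem": the weights
of `RM(d,k)` are divisible by `2^{⌈k/d⌉−1}`, equivalently the bias sum `Σ_x (−1)^{h(x)}` of a degree-`≤ d` function on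
`k` bits is divisible by `2^{⌈k/d⌉}`), stated on COORDINATE CUBES so that it applies verbatim to restrictions: for `h`
of degree `≤ d` (`d ≥ 1`) on `n` bits and a coordinate set `K`, `Σ_{x : supp x ⊆ K} (−1)^{h(x)} ∈ 2^{⌈|K|/d⌉} ℤ`
(`⌈k/d⌉ = (k+d−1)/d`). Elementary proof via `ax_signOf_polyPhase` and `ax_sum_cube_dvd`. [cite: Carlet2020, §4.1] -/
theorem stub_axParity :
    ∀ (n d : ℕ) (h : (Fin n → Bool) → Bool) (K : Finset (Fin n)), 1 ≤ d → IsDegLeFun d h →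
      ∃ z : ℤ, ∑ x ∈ {u : Fin n → Bool | ∀ i, u i = true → i ∈ K}, signOf (h x) =
        (2 : ℝ) ^ ((K.card + d - 1) / d) * (z : ℝ) := by
  intro n d h K hd hh
  obtain ⟨p, hp, hrep⟩ := hh
  obtain ⟨z, hz⟩ := ax_sum_cube_dvd hd hp K
  refine ⟨z, ?_⟩
  rw [sum_congr rfl fun x _ => by rw [hrep x, ax_signOf_polyPhase], ← Int.cast_sum, hz]
  push_cast
  ring

end Summit.QuantumAdvantage.QuantumAdvantage.Theorems.CubicForrelation.NearExactIsExact
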